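import Literature.MathematicalPhysics.QuantumFieldTheory.Balaban1983to89.B4Lemma22L1Stair
import Literature.MathematicalPhysics.QuantumFieldTheory.Balaban1983to89.B4Lemma24ZeroBoxAlphaNegMesh

/-!
# `Balaban1983to89.B2Eq268GaugeAway` — [Balaban1982Higgs2] Lemma 2.4, proof steps **(2.68)** (the expansion of
# `a_kG_k(□,A^{(k)})Q_k^*(A^{(k)})□₁φ` about the constant field `A₀`) and **(2.69)–(2.75)** (the constant field
# «gauged out»: `G_k(□,A₀) = 𝒢(G_k(□,0)⊗1)𝒢ᵀ`, `Q_k(A₀) = ℋQ_k𝒢ᵀ`, (2.74), and `a_kG_k(□,0)Q_k^*1 = a_k/(a_k+m²)`)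
# KERNEL-CHECKED on the B4 lineage's fine box `Π[0,L^kM_μ)` for [B4]'s typed `G_k(□,A)`, `Q_k(A)`, `D^η_A`

statement-level skeleton of published theorems with citation tags; proofs where landed; nothing here is a claim about the Yang–Mills mass gap

CITATION HEADER.  T. Bałaban, *(Higgs)₂,₃ quantum fields in a finite volume. II. An upper bound*, Commun. Math. Phys.
**86** (1982) 555–594, doi:10.1007/bf01214890 [Balaban1982Higgs2] (cell paper B2; journal page = PDF page + 554; pp.
570–574 READ AS IMAGES on the ×2 renders `run/shared/lean/pub/pub-balaban/b2b-balaban-ref1/pages/1982-cmp86-higgs23-II/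
1982-cmp86-higgs23-II-p016…p020-x2.png`); the operators are those of T. Bałaban, *(Higgs)₂,₃ quantum fields in a finite
volume. III. Regularity and decay of lattice Green's functions*, Commun. Math. Phys. **89** (1983) 571–597
[Balaban1983RegularityDecay] (= B4), (1.3)–(1.6) p. 572, (2.24) p. 580, (2.31)–(2.32) p. 581, AS TYPED by the lineage
`B4GaugeCovariance` → `B4Lower18Regular` → `B4Lemma22ReduceZero` → … → `B4Lemma22L1Stair`.  Cell `lit-balaban`, Phase-2
proof seat **p23** gen 5 (unit `lit-balaban-p23-g5`); support file for SKELETON row **B2.Lem2.4** (decl of record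
`…B2.Lemma24Printed`, proved for a model family in the sibling `B2Lemma24Proof`); fold owner r02, referee ref-4.

WHAT IS PRINTED (verbatim, p. 572–573 [PDF 18–19]).  *"Let us denote by A₀ a constant configuration equal to A^{(k)}(y) at
each point, thus A^{(k)} − A₀ = O(p(L^kε)r(L^kε)). Using the expansion formula (I.3.44) and Proposition I.2.2. we have
(a_kG_k(□, A^{(k)})Q_k^*(A^{(k)})□₁φ)(x) = (a_kG_k(□, A₀)Q_k^*(A₀)□₁φ)(x) + (a_kG_k(□, A₀)F_{2,k}(A^{(k)} − A₀, A₀)□₁φ)(x)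
+ (a_kG_k(□, A₀)V_k(A^{(k)} − A₀, A₀)G_k(□, A^{(k)})Q_k^*(A^{(k)})□₁φ)(x) = (a_kG_k(□, A₀)Q_k^*(A₀)□₁φ)(x) + O((L^kε)^{κ₀}),
κ₀ > 0, (2.68) and similarly for the derivative. Now the constant field A₀ can be "gauged out" from the last expression
above. We use a gauge transformation defined on □ by the formula φ₀(x) = U(A₀(Γ_{x,y}))φ₀′(x), x ∈ □ …"* (2.69)–(2.72) *"Hence
the operator +Δ^{η,N}_{A₀,□} + m²(L^kε)² + a_kP_k(A₀)□ is transformed into the operator −Δ^{η,N}_{0,□} + m²(L^kε)² + a_kP_k□,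
and we have G_k(□, A₀; x, x′) = U(A₀(Γ_{x,y}))G_k(□, 0; x, x′)U(A₀(Γ_{y,x′})). (2.73) Together with the gauge transformation of
the propagators we make the corresponding transformation of the field φ, i.e. φ(y′) = U(A₀(Γ_{y′,y}))φ′(y′). Then the last
expression in (2.68) transforms itself as follows (a_kG_k(□, A₀)Q_k^*(A₀)□₁φ)(x) = U(A₀(Γ_{x,y}))(a_kG_k(□, 0)Q_k^*□₁φ′)(x).
(2.74)"* … *"a_kG_k(□, 0)Q_k^*1 = G_k(□, 0)(−Δ^{η,N}_{0,□} + m²(L^kε) + a_kP_k□)1 − m²(L^kε)²G_k(□, 0)Q_k^*1 = 1 −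
m²(L^kε)²G_k(□, 0)Q_k^*1, (2.75)"*.

DICTIONARY (the lineage's, `B4GaugeCovariance`/`B4Lemma22ReduceZero` module docstrings).  □ ↤ the fine box
`Box d ℓ k M = Π[0,(ℓ+1)^kM_μ) ⊂ ℤ^{d+1}` (`η = L^{-k}`, `L = ℓ+1`, `n = L^k` points per unit length); □₂ ↤ its unit sites
`boxDom M`; the N-component fields are `↥Box × ι → ℝ`; `U` ↤ an abelian orthogonal flow `F : OrthFlow ι` with coupling `κ`
(`U(A_b) = F.U (κA_b)`); A^{(k)} on □ ↤ `Ã = constBond A₀ Subtype.val + A'` (`A₀ : Fin (d+1) → ℝ` the constant field,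
`A' = A^{(k)} − A₀`); `a_kG_k(□,A)Q_k^*(A)Ψ` ↤ `a_k • greenA … A *ᵥ ((avgA … A)ᵀ *ᵥ Ψ)` (`a_k = B1.aSeq a L k`; the
weight-1 adjoint block average `(Q_k^*(A)Ψ)(x) = U(A(Γ_{y′,x}))ᵀΨ(y′)`, `x ∈ B^k(y′)`); `F_{2,k}` ↤ `pertF`, `V_k` ↤
`pertV = −vOp` ([B4] (2.24)/(2.31)); `D^η_{A₀,μ}` ↤ `derivA0`; the gauge `U(A₀(Γ_{x,·}))` ↤ `gaugeU … x = F.U (κ·λ(x))`,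
`λ = −⟨A₀,x⟩` (`linGauge`), so that `U(κA₀(u,v)) = gaugeU u · gaugeU vᵀ` — the print's normalisation `λ(y) = 0` is
immaterial (all identities below hold for the unnormalised linear gauge); `G_k(□,0) ⊗ 1` ↤ `gk d ℓ k a m2 M ⊗ₖ 1`
(`gk = (boxOpR n a_k m² M)⁻¹`, `B4BoxCov237`); `‖·‖_∞`/`‖·‖₁` ↤ `supN`/`l1N` (sup / sum over sites of the Euclidean
colour norm `siteNorm`).

WHAT IS PROVED (every theorem from the lineage's definitions; 0 cited facts, no `sorry`).
§1 `avgA_add` — `Q_k(A₀ + A') = Q_k(A₀) + F_{2,k}(A', A₀)` for the fine-box block averages; `expansion268` — the IDENTITY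
behind (2.68): `g = main + a_kG_k(□,A₀)F_{2,k}ᵀΨ + G_k(□,A₀)V_k g`, `g = a_kG_k(□,Ã)Q_k^*(Ã)Ψ`, `main = a_kG_k(□,A₀)Q_k^*(A₀)Ψ`
(from `B4Lemma22ReduceZero.greenA_resolvent` = [B4] (2.31) and `B4Lower18Regular.avgOp_kmul`).
§2 `gaugeU`, `avgA_constBond` — `Q_k(A₀) = ℋ·Q_k·𝒢ᵀ` ((2.71)–(2.72)); `greenA0_eq_gauge` — (2.73); `main_gauge` — **(2.74)**:
`a_kG_k(□,A₀)Q_k^*(A₀)Ψ = 𝒢[a_k(G_k(□,0)⊗1)Q_k^*(ℋᵀΨ)]`, and its covariant derivative `D^η_{A₀,μ}(main) =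
𝒢[(∂^η_μ⊗1)a_k(G_k(□,0)⊗1)Q_k^*(ℋᵀΨ)]` (the structure of (2.77)); `target_gauge` — `Q_k^*(A₀)Ψ = 𝒢(Q_k^*(ℋᵀΨ))`.
§3 `const_box_unif` (the constant-`A₀` rows of [B4] (2.17), uniformly in the coupling `κ`) and `remainder268_sup` — the
REMAINDER OF (2.68) IN `‖·‖_∞`, uniformly on the window and in `κ`: `‖g − main‖_∞ ≤
c·a_kℓ₁τ‖Ψ‖_∞ + c(d+1)ℓ₁θ·Σ_μ‖D^η_{A₀,μ}g‖_∞ + c((d+1)ℓ₁²θ² + a_kℓ₁τ(2+ℓ₁τ) + (d+1)ℓ₁θ)‖g‖_∞` under the size bounds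
`|κA'_b| ≤ θ/n` (the printed «A^{(k)} − A₀ = O(p(L^kε)r(L^kε))», per bond in `η`-units) and `|κA'(Γ_{y,x})| ≤ τ`; here
`G_k(□,A₀)V_k g` is split as in [B4] (2.24): the field-side cross term, the quadratic term and the `a`-terms by the
lineage's sup-row site lemmas (`B4Lemma22PertVSup`), and the DIVERGENCE-FORM cross term `G_k(□,A₀)D^{η*}_{A₀}F_{1,k} g` by
DUALITY — `G_k(□,A₀)ᵀ = G_k(□,A₀)` (`B4Lemma22DualL1.b4Green_transpose`), the `ℓ¹` bound of the field-side cross term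
(`B4Lemma22L1Stair.crossT_l1`) and the `ℓ¹` row of (2.17) at constant `A₀` (`B4Lemma22ReduceZero.zero_box_l1` + the gauge
step, as in `B4Lemma22ConstRows.const_box_l1`) — so that
NO boundary condition on `A'` is needed (in Lemma 2.4, `A' = A^{(k)} − A₀` does not vanish near `∂□`).
§4 **(2.75)** on the box: `gk_rowsum` — `Σ_{x′}G_k(□;x,x′) = (a_k + m²)⁻¹` (from `boxOpR·1 = (m² + a_k)1`,
`B4Lemma24ZeroBoxAlphaNegMesh.boxOpR_mulVec_one`), `fld_mainZero` — `(a_k(G_k(□,0)⊗1)Q_k^*φ′)(x) = a_kΣ_{x′}G_k(□;x,x′)φ′(y(x′))`,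
and `mainZero_const` — `a_k(G_k(□,0)⊗1)Q_k^*(const v) = (a_k/(a_k+m²))·v`, i.e. the printed `a_kG_k(□,0)Q_k^*1 = 1 − m²G_k(□,0)Q_k^*1`
evaluated.
HONEST SCOPE.  (a) Boxes of the lineage only; `Ã`, `A₀`, `A'`, the contour system `Γ` (any system ending at the averaged
point) and the window `a ∈ [amin,aplus]`, `m² ∈ [0,m2plus]`, `k ≥ 1` are free parameters; the identification of `A'` with
Bałaban's `A^{(k)} − A^{(k)}(y)` and of `θ, τ` with `O(p(L^kε)r(L^kε))` is the business of `B2Lemma24Proof`.  (b) §3 bounds the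
VALUE remainder of (2.68) only; the printed «and similarly for the derivative» meets the term `D^η_{A₀}G_k(□,A₀)D^{η*}_{A₀}F_{1,k}`,
which none of the formalised members of [B4] (2.17) controls in `‖·‖_∞` without [B4]'s boundary condition «A' has a compact
support in □» (cell GAPS.md `G-B2-Lem24-D`); it is NOT claimed here.  (c) Invertibility of `H_k(□,Ã)` is a hypothesis
(for the staircase contours under the lineage's smallness it is `B4Lower18Regular.green_box_l2_bound`).  (d) Value = kernel
certificate of printed algebra and of the (2.68) estimate in the lineage's typed setting; NOT summit progress.
-/

namespace Literature.MathematicalPhysics.QuantumFieldTheory.Balaban1983to89.B2Eq268GaugeAway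

open Finset Matrix
open scoped Kronecker
open Literature.MathematicalPhysics.QuantumFieldTheory.Balaban1983to89.B4GaugeCovariance
open Literature.MathematicalPhysics.QuantumFieldTheory.Balaban1983to89.B4Lower18Regular (e1 kmul kmul_apply pertE
  pertT crossOp quadOp pertF vOp lsum fieldLink_add contourTrans_kmul avgOp_kmul sum_blkWt_row sum_blkWt_col)
open Literature.MathematicalPhysics.QuantumFieldTheory.Balaban1983to89.B4Lemma21Region (siteNorm covDeriv)
open Literature.MathematicalPhysics.QuantumFieldTheory.Balaban1983to89.B4Reflection242 (nbrs boxDom blk blk_mem_boxDom)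
open Literature.MathematicalPhysics.QuantumFieldTheory.Balaban1983to89.B4BoxCov237 (boxOpR boxOpR_det_isUnit)
open Literature.MathematicalPhysics.QuantumFieldTheory.Balaban1983to89.B4Lemma22Reduce231
open Literature.MathematicalPhysics.QuantumFieldTheory.Balaban1983to89.B4Lemma21Region (fld_covDeriv_mulVec_of_mem
  fld_covDeriv_mulVec_of_not_mem)
open Literature.MathematicalPhysics.QuantumFieldTheory.Balaban1983to89.B4Lemma22ReduceZero (siteNorm_sum_le Box gk dk
  greenA greenA0 opA pertV derivA derivA0 greenA_resolvent fld_kron_mulVec covDeriv_constBond covDeriv_one)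
open Literature.MathematicalPhysics.QuantumFieldTheory.Balaban1983to89.B4Lemma22ReduceDeriv (siteNorm_flow fld_sub)
open Literature.MathematicalPhysics.QuantumFieldTheory.Balaban1983to89.B4Lemma22PertVSup (siteNorm_neg supN_neg
  supN_smul_le crossT_site quad_site pertFT_site aterm_supN_le' constBond_antisymm blkWt_nonneg contourTrans_fieldLink
  fld_avgOp_transpose_mulVec)
open Literature.MathematicalPhysics.QuantumFieldTheory.Balaban1983to89.B4Lemma22DualL1 (b4Green_transpose)
open Literature.MathematicalPhysics.QuantumFieldTheory.Balaban1983to89.B4Lemma22L1Stair (crossT_l1)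
open Literature.MathematicalPhysics.QuantumFieldTheory.Balaban1983to89.B4Lemma24ZeroBoxAlphaNegMesh (boxOpR_mulVec_one)

noncomputable section

variable {ι : Type} [Fintype ι] [DecidableEq ι]

/-! ## §1 Block averages on the fine box; the identity behind (2.68) -/

section Expansion

variable {d : ℕ}

variable (d) in
/-- **`Q_k(A)` on the fine box** — [B4]'s block-averaging operator (1.4) of the lineage (`avgOp` with the weight-1 block
weights `blkWt` and the contour transporters `U(κA(Γ_{y,x}))`) for the vector field `A`; its transpose is the paper's
`Q_k^*(A)`: `(Q_k^*(A)Ψ)(x) = U(A(Γ_{y′,x}))ᵀΨ(y′)`, `x ∈ B^k(y′)`.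
[cite: Balaban1983RegularityDecay, (1.4) p. 572; Balaban1982Higgs2, (2.65) p. 572] -/
abbrev avgA (F : OrthFlow ι) (κ : ℝ) (ℓ k : ℕ) (M : Fin (d + 1) → ℕ) (emb : ↥(boxDom M) → ↥(Box d ℓ k M))
    (Γ : ↥(boxDom M) → ↥(Box d ℓ k M) → List ↥(Box d ℓ k M)) (A : ↥(Box d ℓ k M) → ↥(Box d ℓ k M) → ℝ) :
    Matrix (↥(boxDom M) × ι) (↥(Box d ℓ k M) × ι) ℝ :=
  avgOp (blkWt ((ℓ + 1) ^ k) M (fun i => (ℓ + 1) ^ k * M i)) (contourTrans (fieldLink F κ A) emb Γ)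

variable (d) in
/-- **`F_{2,k}(A', A₀)` on the fine box** ([B4] p. 580, `B4Lower18Regular.pertF`): `Q_k((U(A'(Γ)) − 1)U(A₀(Γ)))`.
[cite: Balaban1983RegularityDecay, p. 580 (2.24)] -/
abbrev pertF2 (F : OrthFlow ι) (κ : ℝ) (ℓ k : ℕ) (M : Fin (d + 1) → ℕ) (emb : ↥(boxDom M) → ↥(Box d ℓ k M))
    (Γ : ↥(boxDom M) → ↥(Box d ℓ k M) → List ↥(Box d ℓ k M)) (A₀ : Fin (d + 1) → ℝ)
    (A' : ↥(Box d ℓ k M) → ↥(Box d ℓ k M) → ℝ) : Matrix (↥(boxDom M) × ι) (↥(Box d ℓ k M) × ι) ℝ :=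
  pertF (blkWt ((ℓ + 1) ^ k) M (fun i => (ℓ + 1) ^ k * M i)) (contourTrans (fieldLink F κ A') emb Γ)
    (contourTrans (fieldLink F κ (constBond A₀ Subtype.val)) emb Γ)

/-- **`Q_k(A₀ + A') = Q_k(A₀) + F_{2,k}(A', A₀)`** on the fine box ([B4] p. 580 «(F_{2,k}(A',A₀)φ)(y) = Σ …
F'_{1,k}(A'(Γ))U(A₀(Γ))φ(x)»). [cite: Balaban1983RegularityDecay, p. 580] -/
theorem avgA_add (F : OrthFlow ι) (κ : ℝ) (ℓ k : ℕ) (M : Fin (d + 1) → ℕ) (emb : ↥(boxDom M) → ↥(Box d ℓ k M))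
    (Γ : ↥(boxDom M) → ↥(Box d ℓ k M) → List ↥(Box d ℓ k M)) (A₀ : Fin (d + 1) → ℝ)
    (A' : ↥(Box d ℓ k M) → ↥(Box d ℓ k M) → ℝ) :
    avgA d F κ ℓ k M emb Γ (constBond A₀ Subtype.val + A')
      = avgA d F κ ℓ k M emb Γ (constBond A₀ Subtype.val) + pertF2 d F κ ℓ k M emb Γ A₀ A' := by
  have hc : ∀ a b u v : ↥(Box d ℓ k M), fieldLink F κ (constBond A₀ Subtype.val) a b * fieldLink F κ A' u v
      = fieldLink F κ A' u v * fieldLink F κ (constBond A₀ Subtype.val) a b := fun a b u v => F.comm _ _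
  dsimp only [avgA, pertF2]
  rw [fieldLink_add, contourTrans_kmul hc, avgOp_kmul, pertF]

/-- **THE IDENTITY BEHIND (2.68)**: with `g = a_kG_k(□,Ã)Q_k^*(Ã)Ψ`, `Ã = A₀ + A'`, and `main = a_kG_k(□,A₀)Q_k^*(A₀)Ψ`:
`g = main + a_kG_k(□,A₀)F_{2,k}ᵀΨ + G_k(□,A₀)V_k g` — the three printed terms of (2.68), from [B4] (2.31)
`G_k(□,Ã) = G_k(□,A₀) + G_k(□,A₀)V_kG_k(□,Ã)` (`greenA_resolvent`, `V_k = pertV`) and `Q_k(Ã) = Q_k(A₀) + F_{2,k}`.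
[cite: Balaban1982Higgs2, (2.68) p. 572; Balaban1983RegularityDecay, (2.31) p. 581] -/
theorem expansion268 (F : OrthFlow ι) (κ : ℝ) {ℓ k : ℕ} (hℓ : 1 ≤ ℓ) (hk : 1 ≤ k) {a m2 : ℝ} (ha : 0 < a)
    (hm : 0 ≤ m2) {M : Fin (d + 1) → ℕ} (hM : ∀ i, 1 ≤ M i) {emb : ↥(boxDom M) → ↥(Box d ℓ k M)}
    {Γ : ↥(boxDom M) → ↥(Box d ℓ k M) → List ↥(Box d ℓ k M)}
    (hend : ∀ y x, blkWt ((ℓ + 1) ^ k) M (fun i => (ℓ + 1) ^ k * M i) y x ≠ 0 → pathEnd (emb y) (Γ y x) = x)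
    (A₀ : Fin (d + 1) → ℝ) {A' : ↥(Box d ℓ k M) → ↥(Box d ℓ k M) → ℝ}
    (hunit : IsUnit (opA d F κ ℓ k a m2 M emb Γ (constBond A₀ Subtype.val + A')).det) (ak : ℝ)
    (Ψ : ↥(boxDom M) × ι → ℝ) :
    ak • (greenA d F κ ℓ k a m2 M emb Γ (constBond A₀ Subtype.val + A')
        *ᵥ ((avgA d F κ ℓ k M emb Γ (constBond A₀ Subtype.val + A'))ᵀ *ᵥ Ψ))
      = ak • (greenA0 d F κ ℓ k a m2 M emb Γ A₀ *ᵥ ((avgA d F κ ℓ k M emb Γ (constBond A₀ Subtype.val))ᵀ *ᵥ Ψ))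
        + ak • (greenA0 d F κ ℓ k a m2 M emb Γ A₀ *ᵥ ((pertF2 d F κ ℓ k M emb Γ A₀ A')ᵀ *ᵥ Ψ))
        + greenA0 d F κ ℓ k a m2 M emb Γ A₀ *ᵥ (pertV d F κ ℓ k a M emb Γ A₀ A'
            *ᵥ (ak • (greenA d F κ ℓ k a m2 M emb Γ (constBond A₀ Subtype.val + A')
              *ᵥ ((avgA d F κ ℓ k M emb Γ (constBond A₀ Subtype.val + A'))ᵀ *ᵥ Ψ)))) := by
  have hres := greenA_resolvent F κ hℓ hk ha hm hM hend A₀ hunit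
  set G := greenA d F κ ℓ k a m2 M emb Γ (constBond A₀ Subtype.val + A') with hG
  set G₀ := greenA0 d F κ ℓ k a m2 M emb Γ A₀ with hG₀
  set V := pertV d F κ ℓ k a M emb Γ A₀ A' with hV
  set w := (avgA d F κ ℓ k M emb Γ (constBond A₀ Subtype.val + A'))ᵀ *ᵥ Ψ with hw
  have hw' : w = (avgA d F κ ℓ k M emb Γ (constBond A₀ Subtype.val))ᵀ *ᵥ Ψ
      + (pertF2 d F κ ℓ k M emb Γ A₀ A')ᵀ *ᵥ Ψ := by
    rw [hw, avgA_add, Matrix.transpose_add, add_mulVec]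
  have h1 : G *ᵥ w = G₀ *ᵥ w + G₀ *ᵥ (V *ᵥ (G *ᵥ w)) := resolvent_mulVec hres w
  have h2 : G₀ *ᵥ w = G₀ *ᵥ ((avgA d F κ ℓ k M emb Γ (constBond A₀ Subtype.val))ᵀ *ᵥ Ψ)
      + G₀ *ᵥ ((pertF2 d F κ ℓ k M emb Γ A₀ A')ᵀ *ᵥ Ψ) := by rw [hw', mulVec_add]
  calc ak • (G *ᵥ w) = ak • (G₀ *ᵥ w + G₀ *ᵥ (V *ᵥ (G *ᵥ w))) := congrArg (ak • ·) h1
    _ = ak • (G₀ *ᵥ w) + G₀ *ᵥ (V *ᵥ (ak • (G *ᵥ w))) := by rw [smul_add, mulVec_smul, mulVec_smul]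
    _ = _ := by rw [h2, smul_add]

end Expansion

/-! ## §2 The constant field «gauged out»: (2.71)–(2.74) for the lineage's operators -/

section Gauge

variable {d : ℕ}

variable (d) in
/-- **THE GAUGE `U(A₀(Γ_{x,·}))` OF p. 572** in the lineage's form: `𝒢(x) = U(κλ(x))`, `λ(x) = −⟨A₀, x⟩`
(`B4GaugeCovariance.linGauge`), so that every constant-field transporter is `U(κA₀(path u → v)) = 𝒢(u)𝒢(v)ᵀ`
(`fieldLink_constBond`; the closed-contour identities (2.70), (2.72) «A₀(∂Σ) = 0» are this path independence).
[cite: Balaban1982Higgs2, p. 572 «φ₀(x) = U(A₀(Γ_{x,y}))φ₀′(x)», (2.69)–(2.72)] -/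
abbrev gaugeU (F : OrthFlow ι) (κ : ℝ) (ℓ k : ℕ) (M : Fin (d + 1) → ℕ) (A₀ : Fin (d + 1) → ℝ) :
    ↥(Box d ℓ k M) → Matrix ι ι ℝ :=
  fun u => F.U (κ * linGauge A₀ Subtype.val u)

variable (ι d) in
/-- **`Q_k` AT ZERO FIELD** on the fine box: the weight-1 block average with trivial transporters (so that
`(Q_k^*φ′)(x) = φ′(y′)` for `x ∈ B^k(y′)`, `fld_avgOneT`). [cite: Balaban1983RegularityDecay, (1.4) p. 572] -/
abbrev avgOne (ℓ k : ℕ) (M : Fin (d + 1) → ℕ) : Matrix (↥(boxDom M) × ι) (↥(Box d ℓ k M) × ι) ℝ :=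
  avgOp (blkWt ((ℓ + 1) ^ k) M (fun i => (ℓ + 1) ^ k * M i)) (fun _ _ => (1 : Matrix ι ι ℝ))

variable (d) in
/-- the unit site `y(x)` of the block `B^k(y(x)) ∋ x` of a fine box point. [folklore] -/
def blkSite (ℓ k : ℕ) (M : Fin (d + 1) → ℕ) (x : ↥(Box d ℓ k M)) : ↥(boxDom M) :=
  ⟨blk ((ℓ + 1) ^ k) x.1, blk_mem_boxDom (Nat.one_le_pow _ _ (Nat.succ_pos ℓ)) x.2⟩

/-- the block weight of (1.4) selects the block site: `q(y′,x) = 1[y′ = y(x)]` («x ∈ B^k(y)»).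
[cite: Balaban1983RegularityDecay, (1.4) p. 572] -/
theorem blkWt_eq_ite (ℓ k : ℕ) (M : Fin (d + 1) → ℕ) (y : ↥(boxDom M)) (x : ↥(Box d ℓ k M)) :
    blkWt ((ℓ + 1) ^ k) M (fun i => (ℓ + 1) ^ k * M i) y x = if y = blkSite d ℓ k M x then 1 else 0 := by
  unfold blkWt blkSite
  by_cases h : blk ((ℓ + 1) ^ k) x.1 = y.1
  · rw [if_pos h, if_pos (Subtype.ext h.symm)]
  · rw [if_neg h, if_neg fun e => h (congrArg Subtype.val e).symm]

omit [DecidableEq ι] in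
/-- **`(Q_k^*φ′)(x) = φ′(y(x))`** for the zero-field weight-1 block average. [cite: Balaban1983RegularityDecay, (1.4) p. 572] -/
theorem fld_avgOneT [DecidableEq ι] (ℓ k : ℕ) (M : Fin (d + 1) → ℕ) (φ' : ↥(boxDom M) × ι → ℝ) (x : ↥(Box d ℓ k M)) :
    fld ((avgOne ι d ℓ k M)ᵀ *ᵥ φ') x
      = fld φ' (blkSite d ℓ k M x) := by
  rw [fld_avgOp_transpose_mulVec, Finset.sum_eq_single (blkSite d ℓ k M x)]
  · rw [blkWt_eq_ite, if_pos rfl, one_smul, Matrix.transpose_one, one_mulVec]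
  · intro y _ hy
    rw [blkWt_eq_ite, if_neg hy, zero_smul]
  · intro h; exact absurd (Finset.mem_univ _) h

/-- **(2.71)–(2.72): `Q_k(A₀) = ℋ·Q_k·𝒢ᵀ`** — the constant-field block average is the zero-field one dressed with the
gauge at the block sites (`ℋ = ⊕_{y′}𝒢(emb y′)`) and at the fine points, for every contour system ending at the averaged
point («because A₀(Γ_{y,y′} ∪ Γ^{(k)}_{y′,x′} ∪ Γ_{x′,y}) = 0 again»).
[cite: Balaban1982Higgs2, (2.71)–(2.72) p. 573] -/
theorem avgA_constBond (F : OrthFlow ι) (κ : ℝ) (ℓ k : ℕ) (M : Fin (d + 1) → ℕ)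
    {emb : ↥(boxDom M) → ↥(Box d ℓ k M)} {Γ : ↥(boxDom M) → ↥(Box d ℓ k M) → List ↥(Box d ℓ k M)}
    (hend : ∀ y x, blkWt ((ℓ + 1) ^ k) M (fun i => (ℓ + 1) ^ k * M i) y x ≠ 0 → pathEnd (emb y) (Γ y x) = x)
    (A₀ : Fin (d + 1) → ℝ) :
    avgA d F κ ℓ k M emb Γ (constBond A₀ Subtype.val)
      = B4GaugeCovariance.blockDiag (gaugeU d F κ ℓ k M A₀ ∘ emb) * avgOne ι d ℓ k M
          * (B4GaugeCovariance.blockDiag (gaugeU d F κ ℓ k M A₀))ᵀ := by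
  dsimp only [avgA, avgOne, gaugeU]
  rw [fieldLink_constBond, avgOp_contourTrans_gauge (F.isGauge _) _ hend]
  have h1 : contourTrans (fun _ _ : ↥(Box d ℓ k M) => (1 : Matrix ι ι ℝ)) emb Γ = fun _ _ => 1 := by
    funext y x
    exact transport_one _ _
  rw [h1, avgOp_gauge]

/-- **(2.73): `G_k(□,A₀;x,x′) = U(A₀(Γ_{x,y}))G_k(□,0;x,x′)U(A₀(Γ_{y,x′}))`** for the lineage's `G_k(□,A₀)`:
`G_k(□,A₀) = 𝒢(G_k(□)⊗1)𝒢ᵀ` on the window (`b4Green_constBond`, `scalarOp_box`).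
[cite: Balaban1982Higgs2, (2.73) p. 573; Balaban1983RegularityDecay, p. 581] -/
theorem greenA0_eq_gauge (F : OrthFlow ι) (κ : ℝ) {ℓ k : ℕ} (hℓ : 1 ≤ ℓ) (hk : 1 ≤ k) {a m2 : ℝ} (ha : 0 < a)
    (hm : 0 ≤ m2) {M : Fin (d + 1) → ℕ} (hM : ∀ i, 1 ≤ M i) {emb : ↥(boxDom M) → ↥(Box d ℓ k M)}
    {Γ : ↥(boxDom M) → ↥(Box d ℓ k M) → List ↥(Box d ℓ k M)}
    (hend : ∀ y x, blkWt ((ℓ + 1) ^ k) M (fun i => (ℓ + 1) ^ k * M i) y x ≠ 0 → pathEnd (emb y) (Γ y x) = x)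
    (A₀ : Fin (d + 1) → ℝ) :
    greenA0 d F κ ℓ k a m2 M emb Γ A₀
      = blockDiag (gaugeU d F κ ℓ k M A₀) * (gk d ℓ k a m2 M ⊗ₖ (1 : Matrix ι ι ℝ))
          * (blockDiag (gaugeU d F κ ℓ k M A₀))ᵀ := by
  have hL : (1 : ℝ) < (ℓ : ℝ) + 1 := by
    have : (1 : ℝ) ≤ (ℓ : ℝ) := by exact_mod_cast hℓ
    linarith
  have hak : 0 < B1.aSeq a ((ℓ : ℝ) + 1) k := B1.aSeq_pos ha hL hk
  have hn : 1 ≤ (ℓ + 1) ^ k := Nat.one_le_pow _ _ (Nat.succ_pos ℓ)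
  have hS : IsUnit (scalarOp (boxWt ((ℓ + 1) ^ k) (fun i => (ℓ + 1) ^ k * M i)) m2
      (B1.aSeq a ((ℓ : ℝ) + 1) k * (((((ℓ + 1) ^ k : ℕ)) : ℝ) ^ (d + 1))⁻¹)
      (blkWt ((ℓ + 1) ^ k) M (fun i => (ℓ + 1) ^ k * M i))).det := by
    rw [scalarOp_box hn]
    exact boxOpR_det_isUnit hn hak hm hM
  dsimp only [greenA0, gaugeU]
  rw [b4Green_constBond F κ _ m2 _ hend A₀ _ hS, scalarOp_box hn]

/-- **`D^η_{A₀,μ} = 𝒢(∂^η_μ⊗1)𝒢ᵀ`** ((2.69)–(2.70): «(D^η_{A₀}φ₀)(b) = U(A₀(Γ_{b₋,y}))(∂^ηφ₀′)(b)»).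
[cite: Balaban1982Higgs2, (2.69)–(2.70) p. 572] -/
theorem derivA0_eq_gauge (F : OrthFlow ι) (κ : ℝ) (ℓ k : ℕ) (M : Fin (d + 1) → ℕ) (A₀ : Fin (d + 1) → ℝ)
    (μ : Fin (d + 1)) :
    derivA0 d F κ ℓ k M A₀ μ
      = blockDiag (gaugeU d F κ ℓ k M A₀) * (dk d ℓ k M μ ⊗ₖ (1 : Matrix ι ι ℝ))
          * (blockDiag (gaugeU d F κ ℓ k M A₀))ᵀ := by
  dsimp only [derivA0, gaugeU]
  rw [covDeriv_constBond]

/-- `𝒢S𝒢ᵀ·(𝒢w) = 𝒢(Sw)` for a gauge `𝒢` (`𝒢ᵀ𝒢 = 1`) — the operator form of «the same argument with the gauge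
transformation». [cite: Balaban1983RegularityDecay, p. 581] -/
theorem conj_mulVec_gauge {X : Type*} [Fintype X] [DecidableEq X] {g : X → Matrix ι ι ℝ} (hg : IsGauge g)
    (S : Matrix (X × ι) (X × ι) ℝ) (w : X × ι → ℝ) :
    (blockDiag g * S * (blockDiag g)ᵀ) *ᵥ (blockDiag g *ᵥ w) = blockDiag g *ᵥ (S *ᵥ w) := by
  rw [mulVec_mulVec, Matrix.mul_assoc, Matrix.mul_assoc, blockDiag_transpose_mul_self hg, Matrix.mul_one,
    ← mulVec_mulVec]

/-- **THE TARGET OF (2.65) UNDER THE GAUGE**: `Q_k^*(A₀)Ψ = 𝒢·Q_k^*(ℋᵀΨ)` — with `φ′ = ℋᵀφ` (the printed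
«φ(y′) = U(A₀(Γ_{y′,y}))φ′(y′)» up to the immaterial normalisation), `(Q_k^*(A₀)φ)(x) = U(A₀(Γ_{x,·}))φ′(y(x))`.
[cite: Balaban1982Higgs2, p. 573 «φ(y′) = U(A₀(Γ_{y′,y}))φ′(y′)»] -/
theorem target_gauge (F : OrthFlow ι) (κ : ℝ) (ℓ k : ℕ) (M : Fin (d + 1) → ℕ)
    {emb : ↥(boxDom M) → ↥(Box d ℓ k M)} {Γ : ↥(boxDom M) → ↥(Box d ℓ k M) → List ↥(Box d ℓ k M)}
    (hend : ∀ y x, blkWt ((ℓ + 1) ^ k) M (fun i => (ℓ + 1) ^ k * M i) y x ≠ 0 → pathEnd (emb y) (Γ y x) = x)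
    (A₀ : Fin (d + 1) → ℝ) (Ψ : ↥(boxDom M) × ι → ℝ) :
    (avgA d F κ ℓ k M emb Γ (constBond A₀ Subtype.val))ᵀ *ᵥ Ψ
      = blockDiag (gaugeU d F κ ℓ k M A₀)
          *ᵥ ((avgOne ι d ℓ k M)ᵀ *ᵥ ((blockDiag (gaugeU d F κ ℓ k M A₀ ∘ emb))ᵀ *ᵥ Ψ)) := by
  rw [avgA_constBond F κ ℓ k M hend A₀, Matrix.transpose_mul, Matrix.transpose_mul, Matrix.transpose_transpose,
    ← mulVec_mulVec, ← mulVec_mulVec]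

/-- **(2.74): `(a_kG_k(□,A₀)Q_k^*(A₀)□₁φ)(x) = U(A₀(Γ_{x,y}))(a_kG_k(□,0)Q_k^*□₁φ′)(x)`** for the lineage's operators:
`a_kG_k(□,A₀)Q_k^*(A₀)Ψ = 𝒢[a_k(G_k(□)⊗1)Q_k^*(ℋᵀΨ)]` (`φ′ = ℋᵀΨ`; `□₁` is carried by the support of `Ψ`).
[cite: Balaban1982Higgs2, (2.74) p. 573] -/
theorem main_gauge (F : OrthFlow ι) (κ : ℝ) {ℓ k : ℕ} (hℓ : 1 ≤ ℓ) (hk : 1 ≤ k) {a m2 : ℝ} (ha : 0 < a)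
    (hm : 0 ≤ m2) {M : Fin (d + 1) → ℕ} (hM : ∀ i, 1 ≤ M i) {emb : ↥(boxDom M) → ↥(Box d ℓ k M)}
    {Γ : ↥(boxDom M) → ↥(Box d ℓ k M) → List ↥(Box d ℓ k M)}
    (hend : ∀ y x, blkWt ((ℓ + 1) ^ k) M (fun i => (ℓ + 1) ^ k * M i) y x ≠ 0 → pathEnd (emb y) (Γ y x) = x)
    (A₀ : Fin (d + 1) → ℝ) (ak : ℝ) (Ψ : ↥(boxDom M) × ι → ℝ) :
    ak • (greenA0 d F κ ℓ k a m2 M emb Γ A₀ *ᵥ ((avgA d F κ ℓ k M emb Γ (constBond A₀ Subtype.val))ᵀ *ᵥ Ψ))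
      = blockDiag (gaugeU d F κ ℓ k M A₀) *ᵥ (ak • ((gk d ℓ k a m2 M ⊗ₖ (1 : Matrix ι ι ℝ))
          *ᵥ ((avgOne ι d ℓ k M)ᵀ *ᵥ ((blockDiag (gaugeU d F κ ℓ k M A₀ ∘ emb))ᵀ *ᵥ Ψ)))) := by
  rw [target_gauge F κ ℓ k M hend A₀ Ψ, greenA0_eq_gauge F κ hℓ hk ha hm hM hend A₀,
    conj_mulVec_gauge (F.isGauge _), mulVec_smul]

/-- **THE STRUCTURE OF (2.77)**: `D^η_{A₀,μ}[a_kG_k(□,A₀)Q_k^*(A₀)Ψ] = 𝒢[(∂^η_μ⊗1)a_k(G_k(□)⊗1)Q_k^*(ℋᵀΨ)]`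
(«(D^η_{A^{(k)}}φ^{(k)})(b) = U(A₀(Γ_{b₋,y}))(a_k∂^ηG_k(□,0)Q_k^*□₁φ′)(b) + …»).
[cite: Balaban1982Higgs2, (2.77) p. 573, (2.69)–(2.70) p. 572] -/
theorem deriv_main_gauge (F : OrthFlow ι) (κ : ℝ) {ℓ k : ℕ} (hℓ : 1 ≤ ℓ) (hk : 1 ≤ k) {a m2 : ℝ} (ha : 0 < a)
    (hm : 0 ≤ m2) {M : Fin (d + 1) → ℕ} (hM : ∀ i, 1 ≤ M i) {emb : ↥(boxDom M) → ↥(Box d ℓ k M)}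
    {Γ : ↥(boxDom M) → ↥(Box d ℓ k M) → List ↥(Box d ℓ k M)}
    (hend : ∀ y x, blkWt ((ℓ + 1) ^ k) M (fun i => (ℓ + 1) ^ k * M i) y x ≠ 0 → pathEnd (emb y) (Γ y x) = x)
    (A₀ : Fin (d + 1) → ℝ) (ak : ℝ) (Ψ : ↥(boxDom M) × ι → ℝ) (μ : Fin (d + 1)) :
    derivA0 d F κ ℓ k M A₀ μ *ᵥ (ak • (greenA0 d F κ ℓ k a m2 M emb Γ A₀
        *ᵥ ((avgA d F κ ℓ k M emb Γ (constBond A₀ Subtype.val))ᵀ *ᵥ Ψ)))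
      = blockDiag (gaugeU d F κ ℓ k M A₀) *ᵥ ((dk d ℓ k M μ ⊗ₖ (1 : Matrix ι ι ℝ))
          *ᵥ (ak • ((gk d ℓ k a m2 M ⊗ₖ (1 : Matrix ι ι ℝ))
            *ᵥ ((avgOne ι d ℓ k M)ᵀ *ᵥ ((blockDiag (gaugeU d F κ ℓ k M A₀ ∘ emb))ᵀ *ᵥ Ψ))))) := by
  rw [main_gauge F κ hℓ hk ha hm hM hend A₀ ak Ψ, derivA0_eq_gauge, conj_mulVec_gauge (F.isGauge _)]

/-- **THE COMPARISON IN (2.65) IS GAUGE INVARIANT**: `|𝒢w(x) − 𝒢v(x)| = |w(x) − v(x)|` sitewise — the printed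
«taking into account the equalities φ′(y) = φ(y), U(A₀(Γ_{x,y}))φ(y) = …» reduced to the orthogonality of `U`.
[cite: Balaban1982Higgs2, p. 573] -/
theorem siteNorm_gauge_sub (F : OrthFlow ι) (κ : ℝ) (ℓ k : ℕ) (M : Fin (d + 1) → ℕ) (A₀ : Fin (d + 1) → ℝ)
    (w : ↥(Box d ℓ k M) × ι → ℝ) (x : ↥(Box d ℓ k M)) (v : ι → ℝ) :
    siteNorm (fld (blockDiag (gaugeU d F κ ℓ k M A₀) *ᵥ w) x - gaugeU d F κ ℓ k M A₀ x *ᵥ v)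
      = siteNorm (fld w x - v) := by
  rw [fld_blockDiag_mulVec, ← mulVec_sub]
  exact siteNorm_flow F _ _

end Gauge

/-! ## §3 The remainder of (2.68) in `‖·‖_∞` -/

section Remainder

variable {d : ℕ}

/-- `Σ_{μ ∈ Fin (d+1)} t = (d+1)·t`. [folklore] -/
private theorem sum_const_dir (d : ℕ) (t : ℝ) : ∑ _μ : Fin (d + 1), t = ((d : ℝ) + 1) * t := by
  rw [Finset.sum_const, Finset.card_univ, Fintype.card_fin, nsmul_eq_mul]
  push_cast
  ring

/-- **THE CONSTANT-`A₀` ROWS OF [B4] (2.17), UNIFORMLY IN THE COUPLING `κ`** — `B4Lemma22ReduceZero.const_box_sup`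
and `B4Lemma22ConstRows.const_box_l1` restated with `κ` INSIDE the existential (their constant comes from the zero-field
theorems `zero_box_sup`/`zero_box_l1`, which do not see `κ`; the gauge step is repeated verbatim): one `c > 0` with
`‖G_k(□,A₀)Φ‖ ≤ c‖Φ‖`, `‖D^η_{A₀,μ}G_k(□,A₀)Φ‖ ≤ c‖Φ‖` in both `‖·‖_∞` and `‖·‖₁`, for all `κ`, `k ≥ 1`, the window,
all boxes, contour systems and `A₀` (in [B2] the coupling `κ = e(L^kε)η` changes with the step `k`).
[cite: Balaban1983RegularityDecay, Lemma 2.2 (2.17) p. 578; p. 581; p. 583] -/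
theorem const_box_unif (F : OrthFlow ι) (d ℓ : ℕ) (hℓ : 1 ≤ ℓ) (amin aplus m2plus : ℝ) (ha : 0 < amin) :
    ∃ c : ℝ, 0 < c ∧ ∀ (κ : ℝ) (k : ℕ), 1 ≤ k → ∀ (a m2 : ℝ), amin ≤ a → a ≤ aplus → 0 ≤ m2 → m2 ≤ m2plus →
      ∀ (M : Fin (d + 1) → ℕ), (∀ i, 1 ≤ M i) →
      ∀ (emb : ↥(boxDom M) → ↥(Box d ℓ k M)) (Γ : ↥(boxDom M) → ↥(Box d ℓ k M) → List ↥(Box d ℓ k M)),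
        (∀ y x, blkWt ((ℓ + 1) ^ k) M (fun i => (ℓ + 1) ^ k * M i) y x ≠ 0 → pathEnd (emb y) (Γ y x) = x) →
      ∀ (A₀ : Fin (d + 1) → ℝ),
        (∀ Φ : ↥(Box d ℓ k M) × ι → ℝ, supN (greenA0 d F κ ℓ k a m2 M emb Γ A₀ *ᵥ Φ) ≤ c * supN Φ) ∧
        (∀ (μ : Fin (d + 1)) (Φ : ↥(Box d ℓ k M) × ι → ℝ),
            supN (derivA0 d F κ ℓ k M A₀ μ *ᵥ (greenA0 d F κ ℓ k a m2 M emb Γ A₀ *ᵥ Φ)) ≤ c * supN Φ) ∧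
        (∀ f : ↥(Box d ℓ k M) × ι → ℝ, l1N (greenA0 d F κ ℓ k a m2 M emb Γ A₀ *ᵥ f) ≤ c * l1N f) ∧
        (∀ (μ : Fin (d + 1)) (f : ↥(Box d ℓ k M) × ι → ℝ),
            l1N (derivA0 d F κ ℓ k M A₀ μ *ᵥ (greenA0 d F κ ℓ k a m2 M emb Γ A₀ *ᵥ f)) ≤ c * l1N f) := by
  obtain ⟨c₁, hc₁, h₁⟩ := B4Lemma22ReduceZero.zero_box_sup ι d ℓ hℓ amin aplus m2plus ha
  obtain ⟨c₂, hc₂, h₂⟩ := B4Lemma22ReduceZero.zero_box_l1 ι d ℓ hℓ amin aplus m2plus ha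
  refine ⟨max c₁ c₂, lt_max_of_lt_left hc₁, ?_⟩
  intro κ k hk a m2 e1' e2 e3 e4 M hM emb Γ hend A₀
  obtain ⟨h0, hD⟩ := h₁ k hk a m2 e1' e2 e3 e4 M hM
  obtain ⟨l0, lD⟩ := h₂ k hk a m2 e1' e2 e3 e4 M hM
  have hc1 : c₁ ≤ max c₁ c₂ := le_max_left _ _
  have hc2 : c₂ ≤ max c₁ c₂ := le_max_right _ _
  have hg : IsGauge (gaugeU d F κ ℓ k M A₀) := F.isGauge _
  have hG := greenA0_eq_gauge F κ hℓ hk (lt_of_lt_of_le ha e1') e3 hM hend A₀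
  have hDer := derivA0_eq_gauge F κ ℓ k M A₀
  obtain ⟨s0, sD⟩ := B4Lemma22ReduceZero.sup_hyps_conj (κ := Fin (d + 1))
    (D := fun μ => dk d ℓ k M μ ⊗ₖ (1 : Matrix ι ι ℝ)) hg h0 hD
  obtain ⟨t0, tD⟩ := B4Lemma22ReduceZero.l1_hyps_conj (κ := Fin (d + 1))
    (D := fun μ => dk d ℓ k M μ ⊗ₖ (1 : Matrix ι ι ℝ)) hg l0 lD
  refine ⟨fun Φ => ?_, fun μ Φ => ?_, fun f => ?_, fun μ f => ?_⟩
  · rw [hG]; exact (s0 Φ).trans (mul_le_mul_of_nonneg_right hc1 (supN_nonneg Φ))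
  · rw [hG, hDer μ]; exact (sD μ Φ).trans (mul_le_mul_of_nonneg_right hc1 (supN_nonneg Φ))
  · rw [hG]; exact (t0 f).trans (mul_le_mul_of_nonneg_right hc2 (l1N_nonneg f))
  · rw [hG, hDer μ]; exact (tD μ f).trans (mul_le_mul_of_nonneg_right hc2 (l1N_nonneg f))

/-- **THE REMAINDER OF (2.68) IN THE SUP NORM.**  For [B4]'s `G_k(□,Ã)`, `Ã = A₀ + A'` (`A₀` constant) on a fine box of
the lineage, with `g = a_kG_k(□,Ã)Q_k^*(Ã)Ψ` and `main = a_kG_k(□,A₀)Q_k^*(A₀)Ψ`, there is `c > 0` (uniform on the window,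
the box, the contour system, `A₀`, `A'`) such that, IF `H_k(□,Ã)` is invertible, `|κA'_b| ≤ θ/n` on nearest-neighbour
bonds and `|κA'(Γ_{y,x})| ≤ τ` along the block contours, THEN
`‖g − main‖_∞ ≤ c·a_kℓ₁τ‖Ψ‖_∞ + c(d+1)ℓ₁θ·Σ_μ‖D^η_{A₀,μ}g‖_∞ + c((d+1)ℓ₁²θ² + a_kℓ₁τ(2+ℓ₁τ) + (d+1)ℓ₁θ)‖g‖_∞`
— the two printed remainder terms `a_kG_k(□,A₀)F_{2,k}□₁φ` and `a_kG_k(□,A₀)V_kG_k(□,A^{(k)})Q_k^*□₁φ` of (2.68), the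
second split as in [B4] (2.24)/(2.32) with its divergence-form cross term handled by duality (module docstring §3).
In print both are `O((L^kε)^{κ₀})` once `θ, τ = O(p(L^kε)r(L^kε))` and Proposition I.2.2 bounds `‖g‖_∞`, `‖D^η g‖_∞`
(that bookkeeping is `B2Lemma24Proof`'s). [cite: Balaban1982Higgs2, (2.68) p. 572; Balaban1983RegularityDecay, (2.24)
p. 580, (2.31)–(2.32) p. 581, Lemma 2.2 (2.17) p. 578] -/
theorem remainder268_sup (F : OrthFlow ι) {ℓ₁ : ℝ} (hℓ₁ : 0 ≤ ℓ₁)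
    (hLip : ∀ t (v : ι → ℝ), ((F.U t - 1) *ᵥ v) ⬝ᵥ ((F.U t - 1) *ᵥ v) ≤ (ℓ₁ * t) ^ 2 * (v ⬝ᵥ v))
    (d ℓ : ℕ) (hℓ : 1 ≤ ℓ) (amin aplus m2plus : ℝ) (ha : 0 < amin) :
    ∃ c : ℝ, 0 < c ∧ ∀ (κ : ℝ) (k : ℕ), 1 ≤ k → ∀ (a m2 : ℝ), amin ≤ a → a ≤ aplus → 0 ≤ m2 → m2 ≤ m2plus →
      ∀ (M : Fin (d + 1) → ℕ), (∀ i, 1 ≤ M i) →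
      ∀ (emb : ↥(boxDom M) → ↥(Box d ℓ k M)) (Γ : ↥(boxDom M) → ↥(Box d ℓ k M) → List ↥(Box d ℓ k M)),
        (∀ y x, blkWt ((ℓ + 1) ^ k) M (fun i => (ℓ + 1) ^ k * M i) y x ≠ 0 → pathEnd (emb y) (Γ y x) = x) →
      ∀ (A₀ : Fin (d + 1) → ℝ) (A' : ↥(Box d ℓ k M) → ↥(Box d ℓ k M) → ℝ) (θ τ : ℝ),
        IsUnit (opA d F κ ℓ k a m2 M emb Γ (constBond A₀ Subtype.val + A')).det →
        0 ≤ θ → (∀ x y : ↥(Box d ℓ k M), y.1 ∈ nbrs x.1 → |κ * A' x y| ≤ θ / ((ℓ + 1) ^ k : ℕ)) →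
        0 ≤ τ → (∀ y x, blkWt ((ℓ + 1) ^ k) M (fun i => (ℓ + 1) ^ k * M i) y x ≠ 0 →
          |κ * lsum A' (emb y) (Γ y x)| ≤ τ) →
        ∀ Ψ : ↥(boxDom M) × ι → ℝ,
          supN (B1.aSeq a ((ℓ : ℝ) + 1) k • (greenA d F κ ℓ k a m2 M emb Γ (constBond A₀ Subtype.val + A')
                *ᵥ ((avgA d F κ ℓ k M emb Γ (constBond A₀ Subtype.val + A'))ᵀ *ᵥ Ψ))
              - B1.aSeq a ((ℓ : ℝ) + 1) k • (greenA0 d F κ ℓ k a m2 M emb Γ A₀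
                *ᵥ ((avgA d F κ ℓ k M emb Γ (constBond A₀ Subtype.val))ᵀ *ᵥ Ψ)))
            ≤ c * (B1.aSeq a ((ℓ : ℝ) + 1) k * (ℓ₁ * τ)) * supN Ψ
              + c * (((d : ℝ) + 1) * ℓ₁ * θ)
                * ∑ μ, supN (derivA0 d F κ ℓ k M A₀ μ *ᵥ (B1.aSeq a ((ℓ : ℝ) + 1) k
                    • (greenA d F κ ℓ k a m2 M emb Γ (constBond A₀ Subtype.val + A')
                      *ᵥ ((avgA d F κ ℓ k M emb Γ (constBond A₀ Subtype.val + A'))ᵀ *ᵥ Ψ))))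
              + c * (((d : ℝ) + 1) * ℓ₁ ^ 2 * θ ^ 2 + B1.aSeq a ((ℓ : ℝ) + 1) k * (ℓ₁ * τ * (2 + ℓ₁ * τ))
                  + ((d : ℝ) + 1) * ℓ₁ * θ)
                * supN (B1.aSeq a ((ℓ : ℝ) + 1) k
                    • (greenA d F κ ℓ k a m2 M emb Γ (constBond A₀ Subtype.val + A')
                      *ᵥ ((avgA d F κ ℓ k M emb Γ (constBond A₀ Subtype.val + A'))ᵀ *ᵥ Ψ))) := by
  obtain ⟨c, hc, h⟩ := const_box_unif F d ℓ hℓ amin aplus m2plus ha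
  refine ⟨c, hc, ?_⟩
  intro κ k hk a m2 e1' e2 e3 e4 M hM emb Γ hend A₀ A' θ τ hunit hθ hA' hτ0 hτ Ψ
  obtain ⟨h0, -, -, lD⟩ := h κ k hk a m2 e1' e2 e3 e4 M hM emb Γ hend A₀
  have hc0 : 0 ≤ c := hc.le
  have hn : 1 ≤ (ℓ + 1) ^ k := Nat.one_le_pow _ _ (Nat.succ_pos ℓ)
  have hL : (1 : ℝ) < (ℓ : ℝ) + 1 := by
    have : (1 : ℝ) ≤ (ℓ : ℝ) := by exact_mod_cast hℓ
    linarith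
  have hak : 0 < B1.aSeq a ((ℓ : ℝ) + 1) k := B1.aSeq_pos (lt_of_lt_of_le ha e1') hL hk
  have hanti := constBond_antisymm A₀ (Subtype.val : ↥(Box d ℓ k M) → (Fin (d + 1) → ℤ))
  -- the identity (2.68)
  have hexp := expansion268 F κ hℓ hk (lt_of_lt_of_le ha e1') e3 hM hend A₀ hunit (B1.aSeq a ((ℓ : ℝ) + 1) k) Ψ
  -- symmetry of `G_k(□,A₀)`
  have hGt : (greenA0 d F κ ℓ k a m2 M emb Γ A₀)ᵀ = greenA0 d F κ ℓ k a m2 M emb Γ A₀ :=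
    b4Green_transpose F κ _ _ _ _ _ _ _
  set ak := B1.aSeq a ((ℓ : ℝ) + 1) k with hakdef
  set G := greenA d F κ ℓ k a m2 M emb Γ (constBond A₀ Subtype.val + A') with hGdef
  set G₀ := greenA0 d F κ ℓ k a m2 M emb Γ A₀ with hG₀def
  generalize hgdef : ak • (G *ᵥ ((avgA d F κ ℓ k M emb Γ (constBond A₀ Subtype.val + A'))ᵀ *ᵥ Ψ)) = g
    at hexp ⊢
  have hS0 : 0 ≤ ∑ μ, supN (derivA0 d F κ ℓ k M A₀ μ *ᵥ g) := sum_nonneg fun μ _ => supN_nonneg _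
  have hg0 : 0 ≤ supN g := supN_nonneg g
  have hΨ0 : 0 ≤ supN Ψ := supN_nonneg Ψ
  -- the pieces of `V_k = −vOp`
  set C := crossOp (boxWt ((ℓ + 1) ^ k) fun i => (ℓ + 1) ^ k * M i) (fieldLink F κ (constBond A₀ Subtype.val))
    (pertE (fieldLink F κ A')) with hCdef
  set Qd := quadOp (boxWt ((ℓ + 1) ^ k) fun i => (ℓ + 1) ^ k * M i) (pertE (fieldLink F κ A')) with hQddef
  set P := pertF2 d F κ ℓ k M emb Γ A₀ A' with hPdef
  set Q₀ := avgA d F κ ℓ k M emb Γ (constBond A₀ Subtype.val) with hQ₀def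
  set aT := (ak * ((((ℓ + 1) ^ k : ℕ) : ℝ) ^ (d + 1))⁻¹) • (Pᵀ * Q₀ + Q₀ᵀ * P + Pᵀ * P) with haTdef
  have hV : pertV d F κ ℓ k a M emb Γ A₀ A' = -(C + Cᵀ + Qd + aT) := rfl
  -- (i) `a_kG_k(□,A₀)F_{2,k}ᵀΨ`
  have hEF : supN (ak • (G₀ *ᵥ (Pᵀ *ᵥ Ψ))) ≤ c * (ak * (ℓ₁ * τ)) * supN Ψ := by
    refine (supN_smul_le _ _).trans ?_
    rw [abs_of_pos hak]
    have h1 : supN (G₀ *ᵥ (Pᵀ *ᵥ Ψ)) ≤ c * supN (Pᵀ *ᵥ Ψ) := h0 _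
    have h2 : supN (Pᵀ *ᵥ Ψ) ≤ ℓ₁ * τ * supN Ψ :=
      supN_le (mul_nonneg (mul_nonneg hℓ₁ hτ0) hΨ0) fun x =>
        pertFT_site F κ M emb Γ (constBond A₀ Subtype.val) A' hℓ₁ hLip hτ0 hτ Ψ x
    have h3 : c * supN (Pᵀ *ᵥ Ψ) ≤ c * (ℓ₁ * τ * supN Ψ) := mul_le_mul_of_nonneg_left h2 hc0
    nlinarith [h1.trans h3, hak.le]
  -- (ii) the field-side cross term `Cᵀ`: first-order small
  have hCT : supN (G₀ *ᵥ (Cᵀ *ᵥ g))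
      ≤ c * (((d : ℝ) + 1) * ℓ₁ * θ) * ∑ μ, supN (derivA0 d F κ ℓ k M A₀ μ *ᵥ g) := by
    have h1 : supN (G₀ *ᵥ (Cᵀ *ᵥ g)) ≤ c * supN (Cᵀ *ᵥ g) := h0 _
    have h2 : supN (Cᵀ *ᵥ g) ≤ ((d : ℝ) + 1) * ℓ₁ * θ * ∑ μ, supN (derivA0 d F κ ℓ k M A₀ μ *ᵥ g) :=
      supN_le (mul_nonneg (by positivity) hS0) fun z =>
        crossT_site F hℓ₁ hLip κ hn (fun i => (ℓ + 1) ^ k * M i) (constBond A₀ Subtype.val) hanti hθ hA' g z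
    calc supN (G₀ *ᵥ (Cᵀ *ᵥ g)) ≤ c * supN (Cᵀ *ᵥ g) := h1
      _ ≤ c * (((d : ℝ) + 1) * ℓ₁ * θ * ∑ μ, supN (derivA0 d F κ ℓ k M A₀ μ *ᵥ g)) :=
          mul_le_mul_of_nonneg_left h2 hc0
      _ = c * (((d : ℝ) + 1) * ℓ₁ * θ) * ∑ μ, supN (derivA0 d F κ ℓ k M A₀ μ *ᵥ g) := by ring
  -- (iii) the quadratic term
  have hQd : supN (G₀ *ᵥ (Qd *ᵥ g)) ≤ c * (((d : ℝ) + 1) * ℓ₁ ^ 2 * θ ^ 2) * supN g := by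
    have h1 : supN (G₀ *ᵥ (Qd *ᵥ g)) ≤ c * supN (Qd *ᵥ g) := h0 _
    have h2 : supN (Qd *ᵥ g) ≤ ((d : ℝ) + 1) * ℓ₁ ^ 2 * θ ^ 2 * supN g :=
      supN_le (mul_nonneg (by positivity) hg0) fun z =>
        quad_site F hℓ₁ hLip κ hn (fun i => (ℓ + 1) ^ k * M i) hθ hA' g z
    calc supN (G₀ *ᵥ (Qd *ᵥ g)) ≤ c * supN (Qd *ᵥ g) := h1
      _ ≤ c * (((d : ℝ) + 1) * ℓ₁ ^ 2 * θ ^ 2 * supN g) := mul_le_mul_of_nonneg_left h2 hc0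
      _ = c * (((d : ℝ) + 1) * ℓ₁ ^ 2 * θ ^ 2) * supN g := by ring
  -- (iv) the `a`-terms
  have haT : supN (G₀ *ᵥ (aT *ᵥ g)) ≤ c * (ak * (ℓ₁ * τ * (2 + ℓ₁ * τ))) * supN g := by
    have h1 : supN (G₀ *ᵥ (aT *ᵥ g)) ≤ c * supN (aT *ᵥ g) := h0 _
    have h2 : supN (aT *ᵥ g) ≤ ak * (ℓ₁ * τ * (2 + ℓ₁ * τ)) * supN g :=
      aterm_supN_le' F κ M emb Γ (constBond A₀ Subtype.val) A' hℓ₁ hLip hn hτ0 hτ hak.le g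
    calc supN (G₀ *ᵥ (aT *ᵥ g)) ≤ c * supN (aT *ᵥ g) := h1
      _ ≤ c * (ak * (ℓ₁ * τ * (2 + ℓ₁ * τ)) * supN g) := mul_le_mul_of_nonneg_left h2 hc0
      _ = c * (ak * (ℓ₁ * τ * (2 + ℓ₁ * τ))) * supN g := by ring
  -- (v) the divergence-form cross term `C`, by duality: `G₀C = (CᵀG₀)ᵀ`, `‖CᵀG₀u‖₁ ≤ ℓ₁θ(d+1)c‖u‖₁`
  have hCC : supN (G₀ *ᵥ (C *ᵥ g)) ≤ c * (((d : ℝ) + 1) * ℓ₁ * θ) * supN g := by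
    have hT : G₀ * C = (Cᵀ * G₀)ᵀ := by rw [Matrix.transpose_mul, Matrix.transpose_transpose, hGt]
    rw [mulVec_mulVec, hT]
    have hl1 : ∀ u, l1N ((Cᵀ * G₀) *ᵥ u) ≤ ℓ₁ * θ * (((d : ℝ) + 1) * c) * l1N u := by
      intro u
      rw [← mulVec_mulVec]
      refine (crossT_l1 F hℓ₁ hLip κ hn (fun i => (ℓ + 1) ^ k * M i) (constBond A₀ Subtype.val) hanti hθ hA'
        (G₀ *ᵥ u)).trans ?_
      rw [mul_assoc (ℓ₁ * θ)]
      refine mul_le_mul_of_nonneg_left ?_ (mul_nonneg hℓ₁ hθ)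
      calc ∑ μ, l1N (derivA0 d F κ ℓ k M A₀ μ *ᵥ (G₀ *ᵥ u)) ≤ ∑ _μ : Fin (d + 1), c * l1N u :=
            sum_le_sum fun μ _ => lD μ u
        _ = ((d : ℝ) + 1) * c * l1N u := by rw [sum_const_dir]; ring
    have hB : 0 ≤ ℓ₁ * θ * (((d : ℝ) + 1) * c) := by positivity
    refine (supN_transpose_le hB hl1 g).trans (le_of_eq ?_)
    ring
  -- assembly
  have hid : g - ak • (G₀ *ᵥ (Q₀ᵀ *ᵥ Ψ)) = ak • (G₀ *ᵥ (Pᵀ *ᵥ Ψ)) + G₀ *ᵥ (pertV d F κ ℓ k a M emb Γ A₀ A' *ᵥ g) := by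
    conv_lhs => rw [hexp]
    abel
  have hVg : G₀ *ᵥ (pertV d F κ ℓ k a M emb Γ A₀ A' *ᵥ g)
      = -(G₀ *ᵥ (C *ᵥ g) + G₀ *ᵥ (Cᵀ *ᵥ g) + G₀ *ᵥ (Qd *ᵥ g) + G₀ *ᵥ (aT *ᵥ g)) := by
    rw [hV, neg_mulVec, mulVec_neg, add_mulVec, add_mulVec, add_mulVec, mulVec_add, mulVec_add, mulVec_add]
  rw [hid, hVg]
  refine (supN_add_le _ _).trans ?_
  rw [supN_neg]
  have hsum : supN (G₀ *ᵥ (C *ᵥ g) + G₀ *ᵥ (Cᵀ *ᵥ g) + G₀ *ᵥ (Qd *ᵥ g) + G₀ *ᵥ (aT *ᵥ g))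
      ≤ c * (((d : ℝ) + 1) * ℓ₁ * θ) * supN g
        + c * (((d : ℝ) + 1) * ℓ₁ * θ) * ∑ μ, supN (derivA0 d F κ ℓ k M A₀ μ *ᵥ g)
        + c * (((d : ℝ) + 1) * ℓ₁ ^ 2 * θ ^ 2) * supN g + c * (ak * (ℓ₁ * τ * (2 + ℓ₁ * τ))) * supN g :=
    ((supN_add_le _ _).trans (add_le_add ((supN_add_le _ _).trans (add_le_add ((supN_add_le _ _).trans
      (add_le_add hCC hCT)) hQd)) haT))
  refine (add_le_add hEF hsum).trans (le_of_eq ?_)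
  ring

end Remainder

/-! ## §4 (2.75) on the box: `a_kG_k(□,0)Q_k^*1 = a_k/(a_k + m²)` -/

section RowSum

variable {d : ℕ}

/-- **`G_k(□)1 = (a_k + m²)⁻¹·1`** — the printed computation (2.75)/(2.62): `(−Δ^{η,N} + m² + a_kP_k)1 = (m² + a_k)1`
(`B4Lemma24ZeroBoxAlphaNegMesh.boxOpR_mulVec_one`: the Neumann Laplacian kills constants, each block holds `n^{d+1}`
points), inverted. [cite: Balaban1982Higgs2, (2.75) p. 573, (2.62)–(2.63) p. 571] -/
theorem gk_mulVec_one {ℓ k : ℕ} (hℓ : 1 ≤ ℓ) (hk : 1 ≤ k) {a m2 : ℝ} (ha : 0 < a) (hm : 0 ≤ m2)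
    {M : Fin (d + 1) → ℕ} (hM : ∀ i, 1 ≤ M i) :
    gk d ℓ k a m2 M *ᵥ (fun _ => (1 : ℝ)) = fun _ => (B1.aSeq a ((ℓ : ℝ) + 1) k + m2)⁻¹ := by
  have hL : (1 : ℝ) < (ℓ : ℝ) + 1 := by
    have : (1 : ℝ) ≤ (ℓ : ℝ) := by exact_mod_cast hℓ
    linarith
  have hak : 0 < B1.aSeq a ((ℓ : ℝ) + 1) k := B1.aSeq_pos ha hL hk
  have hn : 1 ≤ (ℓ + 1) ^ k := Nat.one_le_pow _ _ (Nat.succ_pos ℓ)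
  have hdet := boxOpR_det_isUnit hn hak hm hM
  have h1 : boxOpR ((ℓ + 1) ^ k) (B1.aSeq a ((ℓ : ℝ) + 1) k) m2 M *ᵥ (fun _ => (1 : ℝ))
      = (m2 + B1.aSeq a ((ℓ : ℝ) + 1) k) • fun _ => (1 : ℝ) := by
    funext x
    rw [boxOpR_mulVec_one hn, Pi.smul_apply, smul_eq_mul, mul_one]
  have h2 : gk d ℓ k a m2 M *ᵥ (boxOpR ((ℓ + 1) ^ k) (B1.aSeq a ((ℓ : ℝ) + 1) k) m2 M *ᵥ fun _ => (1 : ℝ))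
      = fun _ => 1 := by
    dsimp only [gk]
    rw [mulVec_mulVec, Matrix.nonsing_inv_mul _ hdet, one_mulVec]
  rw [h1, mulVec_smul] at h2
  funext x
  have h3 := congrFun h2 x
  simp only [Pi.smul_apply, smul_eq_mul] at h3
  exact eq_inv_of_mul_eq_one_left (by linarith [h3])

/-- **THE ROW SUMS `Σ_{x′}G_k(□;x,x′) = (a_k + m²)⁻¹`**. [cite: Balaban1982Higgs2, (2.75) p. 573] -/
theorem gk_rowsum {ℓ k : ℕ} (hℓ : 1 ≤ ℓ) (hk : 1 ≤ k) {a m2 : ℝ} (ha : 0 < a) (hm : 0 ≤ m2)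
    {M : Fin (d + 1) → ℕ} (hM : ∀ i, 1 ≤ M i) (x : ↥(Box d ℓ k M)) :
    ∑ x', gk d ℓ k a m2 M x x' = (B1.aSeq a ((ℓ : ℝ) + 1) k + m2)⁻¹ := by
  have h := congrFun (gk_mulVec_one (d := d) hℓ hk ha hm hM) x
  simp only [mulVec, dotProduct, mul_one] at h
  exact h

omit [DecidableEq ι] in
/-- **`(a_k(G_k(□)⊗1)Q_k^*φ′)(x) = a_kΣ_{x′}G_k(□;x,x′)φ′(y(x′))`** — the gauged main term of (2.74) as a finite sum of
vectors. [cite: Balaban1982Higgs2, (2.74)–(2.76) p. 573] -/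
theorem fld_mainZero [DecidableEq ι] (ℓ k : ℕ) (a m2 : ℝ) (M : Fin (d + 1) → ℕ) (ak : ℝ)
    (φ' : ↥(boxDom M) × ι → ℝ) (x : ↥(Box d ℓ k M)) :
    fld (ak • ((gk d ℓ k a m2 M ⊗ₖ (1 : Matrix ι ι ℝ)) *ᵥ ((avgOne ι d ℓ k M)ᵀ *ᵥ φ'))) x
      = ak • ∑ x', gk d ℓ k a m2 M x x' • fld φ' (blkSite d ℓ k M x') := by
  have h : fld (ak • ((gk d ℓ k a m2 M ⊗ₖ (1 : Matrix ι ι ℝ)) *ᵥ ((avgOne ι d ℓ k M)ᵀ *ᵥ φ'))) x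
      = ak • fld ((gk d ℓ k a m2 M ⊗ₖ (1 : Matrix ι ι ℝ)) *ᵥ ((avgOne ι d ℓ k M)ᵀ *ᵥ φ')) x := rfl
  rw [h, fld_kron_mulVec]
  congr 1
  exact sum_congr rfl fun x' _ => by rw [fld_avgOneT]

/-- **(2.75) EVALUATED: `a_kG_k(□,0)Q_k^*1 = a_k/(a_k + m²)·1`** — for a constant unit-lattice field `v`,
`a_k(G_k(□)⊗1)Q_k^*v = (a_k/(a_k+m²))v` at every fine point (the printed `1 − m²(L^kε)²G_k(□,0)Q_k^*1`, solved).
[cite: Balaban1982Higgs2, (2.75) p. 573] -/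
theorem mainZero_const {ℓ k : ℕ} (hℓ : 1 ≤ ℓ) (hk : 1 ≤ k) {a m2 : ℝ} (ha : 0 < a) (hm : 0 ≤ m2)
    {M : Fin (d + 1) → ℕ} (hM : ∀ i, 1 ≤ M i) (ak : ℝ) (v : ι → ℝ) (x : ↥(Box d ℓ k M)) :
    fld (ak • ((gk d ℓ k a m2 M ⊗ₖ (1 : Matrix ι ι ℝ)) *ᵥ ((avgOne ι d ℓ k M)ᵀ *ᵥ fun p => v p.2))) x
      = (ak * (B1.aSeq a ((ℓ : ℝ) + 1) k + m2)⁻¹) • v := by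
  rw [fld_mainZero]
  have h : ∀ x' : ↥(Box d ℓ k M), fld (fun p : ↥(boxDom M) × ι => v p.2) (blkSite d ℓ k M x') = v :=
    fun x' => rfl
  simp_rw [h]
  rw [← Finset.sum_smul, gk_rowsum hℓ hk ha hm hM, smul_smul]

/-- **`(∂^η_μ⊗1)` SITEWISE** (a bond of the box): `((∂^η_μ⊗1)W)(x) = n(W(x+e_μ) − W(x))`.
[cite: Balaban1983RegularityDecay, (1.3) p. 572] -/
theorem fld_dk_kron_of_mem (ℓ k : ℕ) (M : Fin (d + 1) → ℕ) (μ : Fin (d + 1)) (W : ↥(Box d ℓ k M) × ι → ℝ)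
    {x : ↥(Box d ℓ k M)} (h : x.1 + e1 μ ∈ Box d ℓ k M) :
    fld ((dk d ℓ k M μ ⊗ₖ (1 : Matrix ι ι ℝ)) *ᵥ W) x
      = ((((ℓ + 1) ^ k : ℕ) : ℝ)) • (fld W ⟨x.1 + e1 μ, h⟩ - fld W x) := by
  dsimp only [dk]
  rw [← covDeriv_one, fld_covDeriv_mulVec_of_mem _ _ W h, one_mulVec]

/-- **`(∂^η_μ⊗1)` SITEWISE** (no bond: Neumann): `((∂^η_μ⊗1)W)(x) = 0` if `x + e_μ ∉ □`.
[cite: Balaban1983RegularityDecay, (1.3) p. 572] -/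
theorem fld_dk_kron_of_not_mem (ℓ k : ℕ) (M : Fin (d + 1) → ℕ) (μ : Fin (d + 1)) (W : ↥(Box d ℓ k M) × ι → ℝ)
    {x : ↥(Box d ℓ k M)} (h : x.1 + e1 μ ∉ Box d ℓ k M) :
    fld ((dk d ℓ k M μ ⊗ₖ (1 : Matrix ι ι ℝ)) *ᵥ W) x = 0 := by
  dsimp only [dk]
  rw [← covDeriv_one, fld_covDeriv_mulVec_of_not_mem _ _ W h]

omit [DecidableEq ι] in
/-- **`(∂^η_μ a_k(G_k(□)⊗1)Q_k^*φ′)(x) = a_kΣ_{x′} n(G_k(□;x+e_μ,x′) − G_k(□;x,x′))φ′(y(x′))`** — the derivative of the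
gauged main term along a bond of the box, as a finite sum of vectors with the DIFFERENCED kernel rows of
`B4Thm110ZeroBoxDeriv`. [cite: Balaban1982Higgs2, (2.77) p. 573] -/
theorem fld_derivMainZero [DecidableEq ι] (ℓ k : ℕ) (a m2 : ℝ) (M : Fin (d + 1) → ℕ) (ak : ℝ)
    (φ' : ↥(boxDom M) × ι → ℝ) (μ : Fin (d + 1)) {x : ↥(Box d ℓ k M)} (h : x.1 + e1 μ ∈ Box d ℓ k M) :
    fld ((dk d ℓ k M μ ⊗ₖ (1 : Matrix ι ι ℝ))
        *ᵥ (ak • ((gk d ℓ k a m2 M ⊗ₖ (1 : Matrix ι ι ℝ)) *ᵥ ((avgOne ι d ℓ k M)ᵀ *ᵥ φ')))) x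
      = ak • ∑ x', ((((ℓ + 1) ^ k : ℕ) : ℝ) * (gk d ℓ k a m2 M ⟨x.1 + e1 μ, h⟩ x' - gk d ℓ k a m2 M x x'))
          • fld φ' (blkSite d ℓ k M x') := by
  rw [fld_dk_kron_of_mem ℓ k M μ _ h, fld_mainZero, fld_mainZero, ← smul_sub, smul_comm, ← Finset.sum_sub_distrib,
    Finset.smul_sum]
  congr 1
  refine sum_congr rfl fun x' _ => ?_
  rw [← sub_smul, smul_smul]

end RowSum

end

end Literature.MathematicalPhysics.QuantumFieldTheory.Balaban1983to89.B2Eq268GaugeAway
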